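import Literature.AlgebraicGeometry.Motives.HodgeLieDirectSum
import Literature.AlgebraicGeometry.Motives.TensorSpaceBlockInsertion
import HarnessLib

/-!
# The Lie algebra of the Hodge group of a block-diagonal direct summand is the restriction:
# `𝔥(H) → 𝔥(H₂)`, `X ↦ π X ι`, is ONTO when `𝔥(H)` is stable under `X ↦ (ιπ) X`

Family `hodge`, layer `Literature/AlgebraicGeometry/Motives`.  Theorems only; no definition, no named fact.  Written for the
cell `pub-hodgecm2` (COR-CM), seat `b27` gen 37 (count-neutral lane MT-RANK-SIX-ISOGENY, part C).

For a retract `ι : H₂ → H`, `π : H → H₂`, `π ι = id`, of pure `ℚ`-Hodge structures, `π 𝔥(H) ι ⊆ 𝔥(H₂)`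
(`comp_mem_hodgeLie_of_retract`, `Motives/HodgeLieDirectSum`).  The reverse inclusion — «the projections
`Hg(X₁ × X₂) → Hg(X_i)` are surjective» (Moonen–Zarhin 1999 §3) — is a statement about algebraic groups; here we prove
its Lie-algebra form in the case that matters for a CM complement: if `𝔥(H)` is BLOCK DIAGONAL for the idempotent
`e = ι π`, i.e. `e X ∈ 𝔥(H)` for every `X ∈ 𝔥(H)`, then EVERY `Y ∈ 𝔥(H₂)` extends by zero:
`ι Y π ∈ 𝔥(H)` (`comp_mem_hodgeLie_of_block`), so `𝔥(H₂) = π 𝔥(H) ι` (`hodgeLie_eq_restrict_of_block`).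

PROOF.  Let `t` be a Hodge tensor of `H` in `T^{a,b}` and `s = ρ(ιYπ) t`.  By
`eq_zero_of_forall_tensorPairing_piecewise_eq_zero` it suffices that `⟨J z, s⟩ = 0` for every block insertion
`J : T^{b',a'}(V₂) → T^{b,a}(V)` (`Motives/TensorSpaceBlockInsertion`).  By invariance of the pairing and naturality,
`⟨J z, ρ(ιYπ) t⟩ = −⟨J(ρ(Y) z), t⟩ = −⟨t₂, ρ(Y) z⟩ = ⟨ρ(Y) t₂, z⟩` where `t₂ ∈ T^{a',b'}(V₂)` represents the functional
`z ↦ ⟨J z, t⟩` (the pairing is perfect).  The same computation with `πXι`, `X ∈ 𝔥(H)`, in place of `Y` shows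
`ρ(πXι) t₂ = 0`, because `ι(πXι)π = eX ∈ 𝔥(H)` kills `t`.  Finally (§1) a rational tensor of `V₂` killed by the subspace
`𝔤 = π 𝔥(H) ι` is a Hodge class of `H₂`, since `𝔤_ℂ` contains an infinitesimal Hodge operator `Θ₂` of `H₂` (§2:
`Θ₂ = π Θ_H ι` with `Θ_H ∈ 𝔥(H)_ℂ`, `mem_hodgeLieC_of_forall_piece`) and a rational tensor killed by `Θ₂` sits in the
degree-`p` part of a graded tensor basis (Deligne, Hodge II, 1.1.12); so `ρ(Y) t₂ = 0` for `Y ∈ 𝔥(H₂)`.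

* §1 `tensorDerivation_eq_zero_of_forall_of_theta_mem_span` — rational tensors killed by a subspace `𝔤 ⊆ End V₂` with
  `Θ₂ ∈ 𝔤_ℂ` are killed by `𝔥(H₂)`.
* §2 `exists_theta_mem_span_restrict` — `π Θ_H ι` is an infinitesimal Hodge operator of `H₂` inside `(π 𝔥(H) ι)_ℂ`.
* §3 **`comp_mem_hodgeLie_of_block`**, `hodgeLie_eq_restrict_of_block`, `finrank_hodgeLie_eq_of_block`.

## References
* [Deligne1982HodgeCycles] P. Deligne, *Hodge cycles on abelian varieties*, LNM 900 (1982), I §3.1 and Prop. 3.4.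
  [cite: Deligne1982HodgeCycles, I §3.1 and Prop. 3.4]
* [MoonenZarhin1999LowDim] B. Moonen, Yu. Zarhin, Math. Ann. 315 (1999), §3 first paragraph («the projections are
  surjective»). [cite: MoonenZarhin1999LowDim, §3]
* [DeligneHodgeII1971] P. Deligne, *Théorie de Hodge II*, 1.1.12 and 1.2.5. [cite: DeligneHodgeII1971, 1.1.12 and 1.2.5]
* [Huybrechts2016K3] D. Huybrechts, *Lectures on K3 Surfaces*, §3.3.4 and Thm. 3.3.9. [cite: Huybrechts2016K3, §3.3.4]
-/

noncomputable section

open scoped TensorProduct PiTensorProduct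

namespace Literature.AlgebraicGeometry.Motives

namespace HodgeStructure

universe u

variable {V₂ : Type u} [AddCommGroup V₂] [Module ℚ V₂] [Module.Finite ℚ V₂]
  {V : Type u} [AddCommGroup V] [Module ℚ V] [Module.Finite ℚ V] [HodgeTensorFacts.{u, u}] {n : ℤ}

/-! ### §1 Rational tensors killed by a subspace containing `Θ₂` over `ℂ` are killed by `𝔥(H₂)` -/

/-- **A rational tensor of `V₂` killed by a `ℚ`-subspace `𝔤 ⊆ End V₂` whose complex span contains an infinitesimal Hodge
operator `Θ₂` of `H₂` (acting on `V₂^{p,n-p}` by `2p − n`) is killed by `𝔥(H₂)`.**  In a graded basis `Θ₂` is diagonal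
on the tensor basis with eigenvalue `2·deg − (a−b)n` (`tensorDerivation_hodgeTensorBasis'`), so a rational `u` with
`ρ(Θ₂)(ι u) = 0` has only components of degree `p`, `2p = (a−b)n`: it lies in `F^p`, i.e. is a Hodge class of type
`(p,p)` (Deligne, Hodge II, 1.1.12), killed by `𝔥(H₂)`; if `(a−b)n` is odd, `u = 0`.
[cite: DeligneHodgeII1971, 1.1.12 and 1.2.5] [cite: Deligne1982HodgeCycles, I Prop. 3.4] -/
theorem tensorDerivation_eq_zero_of_forall_of_theta_mem_span (H₂ : HodgeStructure V₂ n)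
    {g : Set (Module.End ℚ V₂)} {Θ : Module.End ℂ (ℂ ⊗[ℚ] V₂)}
    (hΘg : Θ ∈ Submodule.span ℂ ((fun X : Module.End ℚ V₂ => X.baseChange ℂ) '' g))
    (hΘ : ∀ p, ∀ x ∈ H₂.piece p (n - p), Θ x = ((2 * p - n : ℤ) : ℂ) • x)
    {a b : ℕ} {u : hodgeTensorSpace V₂ a b} (hu : ∀ z ∈ g, tensorDerivation a b z u = 0)
    {Y : Module.End ℚ V₂} (hY : Y ∈ H₂.hodgeLie) : tensorDerivation a b Y u = 0 := by
  classical
  obtain ⟨S, deg, e, hF, hFc⟩ := exists_basis_F_eq_span H₂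
  haveI : Fintype S := FiniteDimensional.fintypeBasisIndex e
  -- `Θ` kills `ι u`
  have hspan : ∀ Z ∈ Submodule.span ℂ ((fun X : Module.End ℚ V₂ => X.baseChange ℂ) '' g),
      tensorDerivation a b Z (tensorSpaceToBaseChange ℂ V₂ a b u) = 0 := by
    intro Z hZ
    induction hZ using Submodule.span_induction with
    | mem Z hZ =>
      obtain ⟨X, hX, rfl⟩ := hZ
      rw [tensorDerivation_baseChange_tensorSpaceToBaseChange, hu X hX, map_zero]
    | zero => simp
    | add Z Z' _ _ hZ hZ' => rw [map_add, LinearMap.add_apply, hZ, hZ', add_zero]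
    | smul c Z _ hZ => rw [map_smul, LinearMap.smul_apply, hZ, smul_zero]
  have hΘu := hspan Θ hΘg
  -- `Θ` is diagonal on the tensor basis, with eigenvalue `2·deg − (a−b)n`
  have hdiag : ∀ σ, Θ (e σ) = ((1 : ℂ) * ((2 * deg σ - n : ℤ) : ℂ)) • e σ := fun σ => by
    rw [one_mul]
    exact apply_basis_eq_of_forall_piece H₂ e hF hFc (f := fun d => ((2 * d - n : ℤ) : ℂ)) hΘ σ
  have hEx : ∀ x, tensorDerivation a b Θ (hodgeTensorBasis e a b x) =
      ((2 * tensorDegree deg x - ((a : ℤ) - b) * n : ℤ) : ℂ) • hodgeTensorBasis e a b x := by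
    intro x
    rw [tensorDerivation_hodgeTensorBasis' e hdiag x]
    congr 1
    rw [← Finset.mul_sum, ← Finset.mul_sum, ← mul_sub, tensorDegree_apply, one_mul]
    push_cast
    simp only [Finset.sum_sub_distrib, Finset.sum_const, Finset.card_univ, Fintype.card_fin, nsmul_eq_mul,
      ← Finset.mul_sum]
    ring
  -- coefficients: `c_x · (2·deg x − (a−b)n) = 0`
  have hsum : tensorSpaceToBaseChange ℂ V₂ a b u =
      ∑ x, (hodgeTensorBasis e a b).repr (tensorSpaceToBaseChange ℂ V₂ a b u) x • hodgeTensorBasis e a b x :=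
    ((hodgeTensorBasis e a b).sum_repr _).symm
  have hcoef : ∀ x, (hodgeTensorBasis e a b).repr (tensorSpaceToBaseChange ℂ V₂ a b u) x *
      ((2 * tensorDegree deg x - ((a : ℤ) - b) * n : ℤ) : ℂ) = 0 := by
    have h0 : tensorDerivation a b Θ (tensorSpaceToBaseChange ℂ V₂ a b u) =
        ∑ x, ((hodgeTensorBasis e a b).repr (tensorSpaceToBaseChange ℂ V₂ a b u) x *
          ((2 * tensorDegree deg x - ((a : ℤ) - b) * n : ℤ) : ℂ)) • hodgeTensorBasis e a b x := by
      conv_lhs => rw [hsum]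
      rw [map_sum]
      refine Finset.sum_congr rfl fun x _ => ?_
      rw [map_smul, hEx, smul_smul]
    have hrepr := (hodgeTensorBasis e a b).repr_sum_self
      (fun x => (hodgeTensorBasis e a b).repr (tensorSpaceToBaseChange ℂ V₂ a b u) x *
        ((2 * tensorDegree deg x - ((a : ℤ) - b) * n : ℤ) : ℂ))
    rw [← h0, hΘu, map_zero] at hrepr
    intro x
    have hx := congrFun hrepr x
    rw [Finsupp.coe_zero, Pi.zero_apply] at hx
    exact hx.symm
  have hsupp : ∀ x, (hodgeTensorBasis e a b).repr (tensorSpaceToBaseChange ℂ V₂ a b u) x ≠ 0 →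
      2 * tensorDegree deg x = ((a : ℤ) - b) * n := by
    intro x hx
    rcases mul_eq_zero.1 (hcoef x) with h | h
    · exact absurd h hx
    · have h' : (2 * tensorDegree deg x - ((a : ℤ) - b) * n : ℤ) = 0 := by exact_mod_cast h
      omega
  by_cases hab : ∃ p : ℤ, ((a : ℤ) - b) * n = 2 * p
  · obtain ⟨p, hp⟩ := hab
    -- `ι u ∈ span {E x | p ≤ deg x}`, hence `1 ⊗ u ∈ F^p`, so `u` is a Hodge class of type `(p,p)`
    have hmem : tensorSpaceToBaseChange ℂ V₂ a b u ∈
        Submodule.span ℂ (hodgeTensorBasis e a b '' {x | p ≤ tensorDegree deg x}) := by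
      rw [Module.Basis.mem_span_image]
      intro x hx
      have hx' : (hodgeTensorBasis e a b).repr (tensorSpaceToBaseChange ℂ V₂ a b u) x ≠ 0 := by
        simpa using hx
      have := hsupp x hx'
      change p ≤ tensorDegree deg x
      omega
    have hu' : u ∈ (H₂.tensorSpace a b).hodgeClasses p := by
      rw [mem_hodgeClasses_iff, ofRat_apply, tensorSpace_F_eq_span H₂ e hF a b p,
        show ((1 : ℂ) ⊗ₜ[ℚ] u) = (hodgeTensorSpaceBaseChange V₂ a b).symm (tensorSpaceToBaseChange ℂ V₂ a b u) by
          rw [← hodgeTensorSpaceBaseChange_one_tmul, LinearEquiv.symm_apply_apply]]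
      have h := Submodule.mem_map_of_mem (f := (hodgeTensorSpaceBaseChange V₂ a b).symm.toLinearMap) hmem
      rw [Submodule.map_span, ← Set.image_comp] at h
      have hfun : ((hodgeTensorSpaceBaseChange V₂ a b).symm.toLinearMap ∘ hodgeTensorBasis e a b) =
          hodgeTensorBasisBC e a b := by
        funext x
        simp [hodgeTensorBasisBC]
      rw [hfun] at h
      exact h
    exact (mem_hodgeLie_iff H₂ Y).1 hY a b p hp u hu'
  · -- `(a−b)n` odd: all coefficients vanish, `u = 0`
    have hzero : tensorSpaceToBaseChange ℂ V₂ a b u = 0 := by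
      rw [hsum]
      refine Finset.sum_eq_zero fun x _ => ?_
      by_cases hx : (hodgeTensorBasis e a b).repr (tensorSpaceToBaseChange ℂ V₂ a b u) x = 0
      · rw [hx, zero_smul]
      · exact absurd ⟨tensorDegree deg x, (hsupp x hx).symm⟩ hab
    have hu0 : u = 0 := tensorSpaceToBaseChange_injective V₂ a b (by rw [hzero, map_zero])
    rw [hu0, map_zero]

/-! ### §2 The infinitesimal Hodge operator of the summand inside the restricted Lie algebra -/

variable {H₂ : HodgeStructure V₂ n} {H : HodgeStructure V n}

omit [Module.Finite ℚ V₂] in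
/-- **`π Θ_H ι` is an infinitesimal Hodge operator of `H₂` lying in `(π 𝔥(H) ι)_ℂ`** for a retract `ι : H₂ → H`,
`π : H → H₂`, `π ι = id`: `Θ_H ∈ 𝔥(H)_ℂ` (`mem_hodgeLieC_of_forall_piece`), `Z ↦ π Z ι` is `ℂ`-linear and commutes
with complexification, and morphisms of Hodge structures map `V₂^{p,q}` into `V^{p,q}`.
[cite: Huybrechts2016K3, §3.3.4] [cite: Deligne1982HodgeCycles, I Prop. 3.4] -/
theorem exists_theta_mem_span_restrict (ι : Hom H₂ H) (π : Hom H H₂)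
    (hπι : ∀ v, π.toLinearMap (ι.toLinearMap v) = v) :
    ∃ Θ ∈ Submodule.span ℂ ((fun X : Module.End ℚ V₂ => X.baseChange ℂ) ''
        ((fun X : Module.End ℚ V => π.toLinearMap ∘ₗ X ∘ₗ ι.toLinearMap) '' (H.hodgeLie : Set (Module.End ℚ V)))),
      ∀ p, ∀ x ∈ H₂.piece p (n - p), Θ x = ((2 * p - n : ℤ) : ℂ) • x := by
  obtain ⟨ΘH, hΘH⟩ := exists_hodgeTheta H
  have hmem : ΘH ∈ H.hodgeLieC := mem_hodgeLieC_of_forall_piece H hΘH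
  have hπιc : π.toLinearMap ∘ₗ ι.toLinearMap = LinearMap.id := LinearMap.ext hπι
  have hmap : ∀ Z ∈ H.hodgeLieC, π.toLinearMap.baseChange ℂ ∘ₗ Z ∘ₗ ι.toLinearMap.baseChange ℂ ∈
      Submodule.span ℂ ((fun X : Module.End ℚ V₂ => X.baseChange ℂ) ''
        ((fun X : Module.End ℚ V => π.toLinearMap ∘ₗ X ∘ₗ ι.toLinearMap) '' (H.hodgeLie : Set (Module.End ℚ V)))) := by
    intro Z hZ
    unfold hodgeLieC at hZ
    induction hZ using Submodule.span_induction with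
    | mem Z hZ =>
      obtain ⟨X, hX, rfl⟩ := hZ
      refine Submodule.subset_span ⟨π.toLinearMap ∘ₗ X ∘ₗ ι.toLinearMap, ⟨X, hX, rfl⟩, ?_⟩
      simp only [LinearMap.baseChange_comp]
    | zero =>
      rw [LinearMap.zero_comp, LinearMap.comp_zero]
      exact Submodule.zero_mem _
    | add Z Z' _ _ hZ hZ' =>
      rw [LinearMap.add_comp, LinearMap.comp_add]
      exact Submodule.add_mem _ hZ hZ'
    | smul c Z _ hZ =>
      rw [LinearMap.smul_comp, LinearMap.comp_smul]
      exact Submodule.smul_mem _ c hZ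
  refine ⟨π.toLinearMap.baseChange ℂ ∘ₗ ΘH ∘ₗ ι.toLinearMap.baseChange ℂ, hmap ΘH hmem, ?_⟩
  · intro p x hx
    have hιx : ι.toLinearMap.baseChange ℂ x ∈ H.piece p (n - p) := ι.map_piece_le p (n - p) ⟨x, hx, rfl⟩
    rw [LinearMap.comp_apply, LinearMap.comp_apply, hΘH p _ hιx, map_smul, ← LinearMap.comp_apply,
      ← LinearMap.baseChange_comp, hπιc, LinearMap.baseChange_id, LinearMap.id_apply]

/-! ### §3 Surjectivity of the restriction for a block-diagonal summand -/

/-- **Extension by zero: `ι Y π ∈ 𝔥(H)` for every `Y ∈ 𝔥(H₂)` when `𝔥(H)` is block diagonal for `e = ι π`.**  For a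
retract `ι : H₂ → H`, `π : H → H₂`, `π ι = id`, of pure `ℚ`-Hodge structures such that `e X ∈ 𝔥(H)` for all
`X ∈ 𝔥(H)`, the restriction `𝔥(H) → 𝔥(H₂)`, `X ↦ π X ι`, is onto: every `Y ∈ 𝔥(H₂)` satisfies `ι Y π ∈ 𝔥(H)` (see the
module docstring for the proof).  Lie-algebra form of the surjectivity of `Hg(H) → Hg(H₂)` for a direct summand whose
Hodge Lie algebra splits off. [cite: Deligne1982HodgeCycles, I §3.1 and Prop. 3.4] [cite: MoonenZarhin1999LowDim, §3] -/
theorem comp_mem_hodgeLie_of_block (ι : Hom H₂ H) (π : Hom H H₂)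
    (hπι : ∀ v, π.toLinearMap (ι.toLinearMap v) = v)
    (hblock : ∀ X ∈ H.hodgeLie, (ι.toLinearMap ∘ₗ π.toLinearMap) ∘ₗ X ∈ H.hodgeLie)
    {Y : Module.End ℚ V₂} (hY : Y ∈ H₂.hodgeLie) :
    ι.toLinearMap ∘ₗ Y ∘ₗ π.toLinearMap ∈ H.hodgeLie := by
  classical
  have hπιc : π.toLinearMap ∘ₗ ι.toLinearMap = LinearMap.id := LinearMap.ext hπι
  obtain ⟨Θ, hΘmem, hΘ⟩ := exists_theta_mem_span_restrict ι π hπι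
  -- `X ∈ 𝔥(H)` commutes with `e = ι π`, so `ι (π X ι) π = e X ∈ 𝔥(H)`
  have he : ι.toLinearMap ∘ₗ π.toLinearMap ∈ H.endAlg := Hom.toLinearMap_mem_endAlg (ι.comp π)
  have hext : ∀ X ∈ H.hodgeLie,
      ι.toLinearMap ∘ₗ (π.toLinearMap ∘ₗ X ∘ₗ ι.toLinearMap) ∘ₗ π.toLinearMap ∈ H.hodgeLie := by
    intro X hX
    have hXe : X * (ι.toLinearMap ∘ₗ π.toLinearMap) = (ι.toLinearMap ∘ₗ π.toLinearMap) * X :=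
      commute_of_mem_hodgeLie H hX ⟨_, he⟩
    have heq : ι.toLinearMap ∘ₗ (π.toLinearMap ∘ₗ X ∘ₗ ι.toLinearMap) ∘ₗ π.toLinearMap =
        (ι.toLinearMap ∘ₗ π.toLinearMap) ∘ₗ X := by
      refine LinearMap.ext fun v => ?_
      have h3 := LinearMap.congr_fun hXe v
      simp only [Module.End.mul_apply, LinearMap.comp_apply] at h3
      simp only [LinearMap.comp_apply]
      rw [h3, hπι]
    rw [heq]
    exact hblock X hX
  rw [mem_hodgeLie_iff]
  intro a b p hab t ht
  refine eq_zero_of_forall_tensorPairing_piecewise_eq_zero ι.toLinearMap π.toLinearMap _ fun S T w ψ => ?_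
  -- the block insertion of this pattern
  obtain ⟨J, hJ⟩ := exists_blockInsertion (K := ℚ) ι.toLinearMap π.toLinearMap S T
    (fun i => w i - ι.toLinearMap (π.toLinearMap (w i)))
    (fun j => ψ j - π.toLinearMap.dualMap (ι.toLinearMap.dualMap (ψ j))) S.equivFin T.equivFin
  have hw₁ : ∀ i, π.toLinearMap (w i - ι.toLinearMap (π.toLinearMap (w i))) = 0 := fun i => by
    rw [map_sub, hπι, sub_self]
  have hψ₁ : ∀ j, (ψ j - π.toLinearMap.dualMap (ι.toLinearMap.dualMap (ψ j))) ∘ₗ ι.toLinearMap = 0 := fun j => by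
    refine LinearMap.ext fun x => ?_
    simp [LinearMap.dualMap_apply, hπι]
  rw [← blockInsertion_apply_piecewise hJ]
  set z₀ : hodgeTensorSpaceOver ℚ V₂ S.card T.card :=
    (PiTensorProduct.tprod ℚ fun k => π.toLinearMap (w ((S.equivFin.symm k : ↥S) : Fin b))) ⊗ₜ[ℚ]
      PiTensorProduct.tprod ℚ fun k => ι.toLinearMap.dualMap (ψ ((T.equivFin.symm k : ↥T) : Fin a))
  -- the representing tensor `t₂ ∈ T^{a',b'}(V₂)` of `z ↦ ⟨J z, t⟩`
  obtain ⟨t₂, ht₂⟩ := exists_tensorPairing_eq (K := ℚ) (W := V₂)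
    ((LinearMap.applyₗ t ∘ₗ tensorPairing a b) ∘ₗ J)
  have hlam : ∀ z, tensorPairing a b (J z) t = tensorPairing S.card T.card t₂ z := fun z => by
    have h := LinearMap.congr_fun ht₂ z
    simp only [LinearMap.comp_apply, LinearMap.applyₗ_apply_apply] at h
    exact h.symm
  -- for a block operator `ι Y' π`: `⟨J z, ρ(ι Y' π) t⟩ = ⟨ρ(Y') t₂, z⟩`
  have hkey : ∀ (Y' : Module.End ℚ V₂) (z : hodgeTensorSpaceOver ℚ V₂ S.card T.card),
      tensorPairing a b (J z) (tensorDerivation a b (ι.toLinearMap ∘ₗ Y' ∘ₗ π.toLinearMap) t) =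
        tensorPairing S.card T.card (tensorDerivation T.card S.card Y' t₂) z := by
    intro Y' z
    have hinv := tensorPairing_tensorDerivation_add (ι.toLinearMap ∘ₗ Y' ∘ₗ π.toLinearMap) (J z) t
    have hinv₂ := tensorPairing_tensorDerivation_add Y' t₂ z
    rw [tensorDerivation_blockInsertion hπιc hw₁ hψ₁ hJ Y' z, hlam] at hinv
    linear_combination hinv - hinv₂
  -- `t₂` is killed by `π 𝔥(H) ι`
  have ht₂g : ∀ z' ∈ ((fun X : Module.End ℚ V => π.toLinearMap ∘ₗ X ∘ₗ ι.toLinearMap) ''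
      (H.hodgeLie : Set (Module.End ℚ V))), tensorDerivation T.card S.card z' t₂ = 0 := by
    rintro _ ⟨X, hX, rfl⟩
    apply (tensorPairing_bijective (K := ℚ) (W := V₂) S.card T.card).1
    rw [map_zero]
    refine LinearMap.ext fun z => ?_
    rw [LinearMap.zero_apply, ← hkey,
      (mem_hodgeLie_iff H _).1 (hext X hX) a b p hab t ht, map_zero]
  -- hence by `𝔥(H₂) ∋ Y`
  have hYt₂ : tensorDerivation T.card S.card Y t₂ = 0 :=
    tensorDerivation_eq_zero_of_forall_of_theta_mem_span H₂ hΘmem hΘ ht₂g hY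
  rw [hkey, hYt₂, map_zero, LinearMap.zero_apply]

/-- **`𝔥(H₂) = π 𝔥(H) ι` for a block-diagonal direct summand** (both inclusions: `comp_mem_hodgeLie_of_retract` and
`comp_mem_hodgeLie_of_block`). [cite: Deligne1982HodgeCycles, I Prop. 3.4] [cite: MoonenZarhin1999LowDim, §3] -/
theorem hodgeLie_eq_restrict_of_block (ι : Hom H₂ H) (π : Hom H H₂)
    (hπι : ∀ v, π.toLinearMap (ι.toLinearMap v) = v)
    (hblock : ∀ X ∈ H.hodgeLie, (ι.toLinearMap ∘ₗ π.toLinearMap) ∘ₗ X ∈ H.hodgeLie) :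
    (H₂.hodgeLie : Set (Module.End ℚ V₂)) =
      (fun X : Module.End ℚ V => π.toLinearMap ∘ₗ X ∘ₗ ι.toLinearMap) '' (H.hodgeLie : Set (Module.End ℚ V)) := by
  refine Set.Subset.antisymm (fun Y hY => ?_) ?_
  · refine ⟨ι.toLinearMap ∘ₗ Y ∘ₗ π.toLinearMap, comp_mem_hodgeLie_of_block ι π hπι hblock hY, ?_⟩
    change π.toLinearMap ∘ₗ (ι.toLinearMap ∘ₗ Y ∘ₗ π.toLinearMap) ∘ₗ ι.toLinearMap = Y
    refine LinearMap.ext fun v => ?_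
    simp only [LinearMap.comp_apply, hπι]
  · rintro _ ⟨X, hX, rfl⟩
    exact comp_mem_hodgeLie_of_retract ι π hπι hX

/-- **`dim 𝔥(H₂) = dim (π 𝔥(H) ι)`** for a block-diagonal direct summand: the restriction map
`𝔥(H) → End V₂`, `X ↦ π X ι`, has image of dimension `dim 𝔥(H₂)`. [cite: Deligne1982HodgeCycles, I Prop. 3.4]
[cite: MoonenZarhin1999LowDim, §3] -/
theorem finrank_hodgeLie_eq_of_block (ι : Hom H₂ H) (π : Hom H H₂)
    (hπι : ∀ v, π.toLinearMap (ι.toLinearMap v) = v)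
    (hblock : ∀ X ∈ H.hodgeLie, (ι.toLinearMap ∘ₗ π.toLinearMap) ∘ₗ X ∈ H.hodgeLie) :
    Module.finrank ℚ H₂.hodgeLie =
      Module.finrank ℚ (H.hodgeLie.map
        ((LinearMap.llcomp ℚ V₂ V V₂ π.toLinearMap).comp (LinearMap.lcomp ℚ V ι.toLinearMap))) := by
  have heq : H₂.hodgeLie =
      H.hodgeLie.map ((LinearMap.llcomp ℚ V₂ V V₂ π.toLinearMap).comp (LinearMap.lcomp ℚ V ι.toLinearMap)) := by
    refine SetLike.coe_injective ?_
    rw [Submodule.map_coe, hodgeLie_eq_restrict_of_block ι π hπι hblock]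
    refine Set.image_congr fun X _ => ?_
    rfl
  rw [heq]

end HodgeStructure

end Literature.AlgebraicGeometry.Motives

end
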